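import Mathlib
import HarnessLib
import HarnessLib.Audit
import Summits.Langlands.Langlands.Theorems.MordellWeilFifteenSplit

/-!
# MordellWeilSevenSplit — lens-5 g35 addendum: the LEVEL-7 SIDE of the Mordell–Weil dial (growth of `X₀(21) ≅ 21A1` and
`X(e7) ≅ 49A4` over the witness field) on RES35 = `MordellWeilFifteenSplit.Residual35` and on LJR = `JDegreeFilterSplit.LargeJResidual`

THESIS.  RES35 (tree decl `Summit.Langlands.Langlands.Theorems.MordellWeilFifteenSplit.Residual35`, p835573) is RES34 on the
GROWTH fields of level `15` (`√5 ∈ K₀`, or a new `K₀`-point on `15A1`/`15A3`); its `√5`-sector had NO door (clause (ii) of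
BOX13 = `Box2022_theorem1_3` is void when `√5 ∈ K₀`).  Clauses (i) and (iii) of BOX13 do not see `√5`: a non-automorphic
`E / K₀` has `B(3)`-or-`C_s⁺(3)` shape at `3` ALWAYS, and `B(7)`-or-`G(e7)` shape at `7` whenever `ℚ(ζ₇)⁺ ⊄ K₀`
(`HeptagonalFree K₀ : ∀ x, x³ + x² − 2x − 1 ≠ 0`; automatic when `3 ∤ [K₀:ℚ]`, tree `Box2022.cubic7_ne_zero`).  Such an `E`
is a non-cuspidal `K₀`-point of ONE of `X(b3,b7) = X₀(21)`, `X(s3,b7)`, `X(b3,e7)`, `X(s3,e7)`; and `X₀(21) ≅ 21A1 =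
⟨1,0,0,−4,−1⟩` over `ℚ` [Yoshikawa2022, Lemma 3.1 (3)], `X(s3,b7) ≅ X₀(63)/⟨w₉⟩` is a DOUBLE COVER of `Y = X₀(63)/⟨w₇,w₉⟩ ≅
21A1` [FreitasLeHungSiksek2015, §7, proof of the `ℚ(√5)` lemma; Yoshikawa2022, Lemma 3.1 (4)], and `X(b3,e7)`, `X(s3,e7)`
map to `X(e7) = X(H₂) ≅ 49A4 = ⟨1,−1,0,−1822,30393⟩`, `X(e7)(ℚ) = {two points, both with j = 0}`, `H₂ = ⟨(0 5; 3 0), (5 0;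
3 2)⟩ = G(e7)` [FreitasLeHungSiksek2015, Prop. (large2) (c), Lemma (de7)].  DIAL: `SevenStable K₀ := 21A1(K₀) = 21A1(ℚ) ∧
49A4(K₀) = 49A4(ℚ)` (tree predicate `Thorne2019.PointsRational`).  On a SEVEN-STABLE HEPTAGONAL-FREE field a non-automorphic
`E` therefore has `[ℚ(j(E)):ℚ] ≤ 2` (rational point of `X₀(21)` or `X(e7)`, or a point of `X(s3,b7)` in a degree-`2` fibre
over `Y(ℚ)` — the fibre argument of [Yoshikawa2022, proof of Lemma 3.2]): junction **SMD** `SevenModuliDoor`.  In the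
residual range (`[ℚ(j):ℚ] ≥ 4`) that is absurd: the seven-stable sector of LJR — hence of RES, CORE, …, RES34, RES35 — has
NO candidates (`sevenStableSectorLJR_closed : BOX13 → SMD → SevenStableSectorLJR`), with NO condition at `5` and NO base change.
So RES35 ⟸ SMD ∧ Residual36, `Residual36` := RES35 on the SEVEN-GROWTH fields (`ℚ(ζ₇)⁺ ⊆ K₀`, or a new `K₀`-point on `21A1`
or `49A4`), EXACT (`residual35_iff_residual36`).  One storey up, on fields with NO QUADRATIC SUBFIELD `[ℚ(j):ℚ] ≤ 2` forces
`j ∈ ℚ` and DBC closes: `modular_of_sevenStable_noQuadratic`, and `modular_of_sevenStable_coprime6` — over ANY totally real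
`K` with `gcd([K:ℚ], 6) = 1`, `21A1(K) = 21A1(ℚ)` and `49A4(K) = 49A4(ℚ)` ⇒ every `E / K` is modular (BOX13 ∧ SMD ∧ DBC).

WHY THIS LINE.  The g35 critic (row 514) located all remaining difficulty in RES35 = (`√5`-entangled fields) ∪ (genuine
`15`-growth).  The level-`7` side of the SAME dial type (an absolute Mordell–Weil statistic of the witness field) cuts BOTH:
it needs neither `√5 ∉ K₀` (Thorne 2016) nor `7` unramified (Yoshikawa 2016, Thm. 1.5 — the input of TowerDoorSplit's B7
`stub_door21` and of [Yoshikawa2022, Cor. 3.6 (2)]), only Box's `ℚ(ζ₇)⁺ ⊄ K₀`, because the `e7` shape is ABSORBED by the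
second curve `49A4` instead of being excluded by a lifting theorem.  Nearest tree prior art: `Thorne2019_lemma3` (level `15`,
`K/ℚ` cyclic), g35 `modular_of_stable` (level `15`, `√5 ∉ K`), TowerDoorSplit B7 (anchor `F`, `[K₀:F]` odd, `7 ∤ disc K₀`),
g31 `KalyanswamySevenSector` / `CellB3B5E7` / `CellS3B5E7` (curve-local shape cells, IDEA-NEEDED), HeptagonalTower
`OddDegreeDoor` (`7`-power cyclotomic layers).  DELTA: a field-statistic door at level `7·(e7)` valid for fields CONTAINING
`√5`; at the REST_E storey an absolute criterion for every totally real field of degree prime to `6`.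

RANKED CRUXES.  `Residual36` (rank 2; RESIDUAL, IDEA-NEEDED, WEAKER; INSTRUMENTABLE per field: `2`-descent on `21A1`,
`49A4` over `K₀`).  `SevenModuliDoor` (PRINT JUNCTION, binder).  `SevenStableSector35`, `SevenStableSectorLJR` (WEAKER, CLOSED).

KILL CRITERIA.  A misreading of the moduli step: an `E / K₀` of `e7` shape with `49A4(K₀) = 49A4(ℚ)` and `j(E) ≠ 0`, or of
`s3⁺ ∧ b7` shape over a `21A1`-stable `K₀` with `[ℚ(j(E)):ℚ] ≥ 3` — impossible by [FreitasLeHungSiksek2015, Lemma (de7), §7].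

NOT DECOMPOSED YET.  `Residual36` by source of seven-growth (`ℚ(ζ₇)⁺ ⊆ K₀` vs new points) — the BC3 birth file does exactly this.

CHEAPEST FALSIFIER.  `jDeg ≤ 2` vs `InResidualRange` is kernel-checked (`not_inResidualRange_of_jDeg_le_two`); the junction's
three cases are checked against the cited pages (G(e7) generators = FLS `H₂` verbatim = g31 `E7Seven`).
-/

set_option linter.dupNamespace false
set_option linter.unusedVariables false

open scoped NumberField IntermediateField MatrixGroups Polynomial
open NumberField IsDedekindDomain Field Literature.NumberTheory.Automorphic
open Literature.NumberTheory.GaloisRepresentations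
open Summit.Langlands.Langlands.Theorems.DepthIsolationSplit (UnanchoredBox UnanchoredHighDegreeModularE
  IntegralModelTransferPointwise SatakeAvatarTwo satakeAvatarTwo_of_host modularE_iff_box)
open Summit.Langlands.Langlands.Theorems.JDegreeFilterSplit (jInv jDeg InResidualRange LargeJResidual
  RatBaseChangeModularity SmallFieldBaseChange isModularEllipticCurve_of_jInv_eq_ratCast exists_ratCast_eq_of_jDeg_le_one
  largeJResidual_of_restE)
open Summit.Langlands.Langlands.Theorems.DyadicDoorSplit (AllenLocus AllenDyadicCorollary DyadicDegenerateResidual)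
open Summit.Langlands.Langlands.Theorems.OddPrimeDoorSplit (OffDoors SkinnerWilesDihedralDoor
  PanZhangSupersingularDoor CoreResidual core_of_restE core_of_largeJResidual)
open Summit.Langlands.Langlands.Theorems.RealCyclotomicDoorSplit (BorelAt BorelOrSplitCartanThree BorelOrE7Seven E7Seven
  BoxShape boxShape_of_box13 not_isSquare_five_of_not_two_dvd)
open Summit.Langlands.Langlands.Theorems.ReductionSignatureSplit (OffSignatureDoors NearlyOrdinaryDihedralDoorThree
  SplitOrdinaryDihedralDoor MixedSignatureDoor SignatureResidual signatureResidual_of_core)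
open Summit.Langlands.Langlands.Theorems.NearlyOrdinaryDistinguishedSplit (OnNODDoor NearlyOrdinaryDistinguishedDoor
  NODSector Residual34 residual34_of_core)
open Summit.Langlands.Langlands.Theorems.MordellWeilFifteenSplit (FifteenStable Growth NoQuadraticSubfield FifteenModuliDoor
  StableSector34 Residual35 StableFifteenCell GrowthRestE residual34_of_pieces residual35_of_residual34 residual35_of_core
  residual35_of_restE closes_target closes_byName core_of_pieces35 noQuadraticSubfield_of_not_two_dvd)

namespace Summit.Langlands.Langlands.Theorems.MordellWeilSevenSplit

/-! ## §1 The dial: Mordell–Weil stability of `X₀(21) ≅ 21A1` and `X(e7) ≅ 49A4` over the witness field; `ℚ(ζ₇)⁺ ⊄ K₀` -/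

/-- `21A1 = [1, 0, 0, −4, −1]` (`c₄ = 193`, `Δ = 3⁴·7²`): `≅ X₀(21) = X(b3,b7)` over `ℚ` [Yoshikawa2022, Lemma 3.1 (3)] and
`≅ Y = X₀(63)/⟨w₇, w₉⟩`, the quotient of `X(s3,b7) ≅ X₀(63)/⟨w₉⟩` by `w₇` [FreitasLeHungSiksek2015, §7].  `E21(ℚ) ≅ ℤ/2 ⊕ ℤ/4`. -/
def E21 : WeierstrassCurve ℚ := ⟨1, 0, 0, -4, -1⟩

/-- `49A4 = [1, −1, 0, −1822, 30393]` (`Δ = 7⁹`, `j = 255³`): a Weierstrass model of `X(e7) = X(H₂)` over `ℚ`; `X(e7)(ℚ)` = two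
points, both of moduli `j = 0` [FreitasLeHungSiksek2015, Lemma (de7) and the Remarks after it].  `E49(ℚ) ≅ ℤ/2`. -/
def E49 : WeierstrassCurve ℚ := ⟨1, -1, 0, -1822, 30393⟩

/-- SEVEN-STABILITY of `K₀`: no Mordell–Weil growth of `21A1` and of `49A4` from `ℚ` to `K₀`. -/
def SevenStable (K₀ : Type) [Field K₀] [NumberField K₀] : Prop :=
  Thorne2019.PointsRational E21 K₀ ∧ Thorne2019.PointsRational E49 K₀

/-- `ℚ(ζ₇)⁺ ⊄ K₀`, VERBATIM the hypothesis of clause (iii) of `Box2022_theorem1_3` (the cubic is the minimal polynomial of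
`ζ₇ + ζ₇⁻¹`). -/
def HeptagonalFree (K₀ : Type) [Field K₀] [NumberField K₀] : Prop :=
  ∀ x : K₀, x ^ 3 + x ^ 2 - 2 * x - 1 ≠ 0

/-- SEVEN-GROWTH (the complement): `ℚ(ζ₇)⁺ ⊆ K₀`, or a new `K₀`-point on `21A1` or on `49A4`. -/
def SevenGrowth (K₀ : Type) [Field K₀] [NumberField K₀] : Prop :=
  (∃ x : K₀, x ^ 3 + x ^ 2 - 2 * x - 1 = 0) ∨ ¬ SevenStable K₀

/-! ## §2 The ONE new print junction: the moduli of `X₀(21)`, `X(s3,b7) → Y`, `X(e7)` -/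

/-- **SMD — SEVEN MODULI DOOR** (PRINT JUNCTION, binder, credits nothing).  For `E / 𝓞 K₀` with `Δ ≠ 0`, of `B(3)`-or-`C_s⁺(3)`
shape at `3` and `B(7)`-or-`G(e7)` shape at `7` (g31 decls = clauses (i), (iii) of `Box2022_theorem1_3` verbatim), over a
seven-stable `K₀`: `[ℚ(j(E)):ℚ] ≤ 2`.  Printed proof by cases: `b3 ∧ b7` — a `K₀`-rational `21`-isogeny, a non-cuspidal
`K₀`-point of `X₀(21) ≅ 21A1`, rational by stability, so `j ∈ ℚ`; `s3⁺ ∧ b7` — a `K₀`-point `P` of `X(s3,b7)` whose image in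
`Y ≅ 21A1` is rational, so `P` lies in a degree-`2` fibre over `ℚ`, `[ℚ(P):ℚ] ≤ 2`, and `j(E) = j(P) ∈ ℚ(P)` [Yoshikawa2022,
proof of Lemma 3.2; FreitasLeHungSiksek2015, §7]; `e7` — a `K₀`-point of `X(e7) ≅ 49A4`, rational by stability, so `j = 0`
[FreitasLeHungSiksek2015, Prop. (large2) (c), Lemma (de7)]. -/
def SevenModuliDoor : Prop :=
  ∀ (K₀ : Type) [Field K₀] [NumberField K₀] (E : WeierstrassCurve (𝓞 K₀)), E.Δ ≠ 0 →
    BorelOrSplitCartanThree K₀ E → BorelOrE7Seven K₀ E → SevenStable K₀ → jDeg K₀ E ≤ 2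

/-! ## §3 The pieces -/

/-- SEVEN-STABLE SECTOR of RES35 (WEAKER; CLOSED from BOX13 ∧ SMD, `sevenStableSector35_closed`). -/
def SevenStableSector35 : Prop :=
  ∀ (K₀ : Type) [Field K₀] [NumberField K₀], UnanchoredBox K₀ → Growth K₀ → HeptagonalFree K₀ → SevenStable K₀ →
    ∀ E : WeierstrassCurve (𝓞 K₀), E.Δ ≠ 0 → InResidualRange K₀ E → ¬ AllenLocus K₀ E → OffDoors K₀ E →
      OffSignatureDoors K₀ E → ¬ OnNODDoor K₀ E → IsModularEllipticCurve K₀ E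

/-- **Residual36 — THE DECLARED RESIDUAL** (IDEA-NEEDED, WEAKER): RES35 on the SEVEN-GROWTH fields — `ℚ(ζ₇)⁺ ⊆ K₀`, or
`21A1(K₀) ≠ 21A1(ℚ)`, or `49A4(K₀) ≠ 49A4(ℚ)` (every residual curve on a new-point field lies in a fibre of a level-`105`
or `15·(e7)` modular curve over a NEW `K₀`-point of `21A1` / `49A4`; INSTRUMENTABLE per field by `2`-descent). -/
def Residual36 : Prop :=
  ∀ (K₀ : Type) [Field K₀] [NumberField K₀], UnanchoredBox K₀ → Growth K₀ → SevenGrowth K₀ →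
    ∀ E : WeierstrassCurve (𝓞 K₀), E.Δ ≠ 0 → InResidualRange K₀ E → ¬ AllenLocus K₀ E → OffDoors K₀ E →
      OffSignatureDoors K₀ E → ¬ OnNODDoor K₀ E → IsModularEllipticCurve K₀ E

/-- SEVEN-STABLE SECTOR of LJR, six storeys up (WEAKER than `LargeJResidual`; CLOSED from BOX13 ∧ SMD — theorem-void). -/
def SevenStableSectorLJR : Prop :=
  ∀ (K₀ : Type) [Field K₀] [NumberField K₀], UnanchoredBox K₀ → HeptagonalFree K₀ → SevenStable K₀ →
    ∀ E : WeierstrassCurve (𝓞 K₀), E.Δ ≠ 0 → InResidualRange K₀ E → IsModularEllipticCurve K₀ E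

/-- SEVEN-GROWTH part of LJR (WEAKER than `LargeJResidual`; IDEA-NEEDED). -/
def SevenGrowthLJR : Prop :=
  ∀ (K₀ : Type) [Field K₀] [NumberField K₀], UnanchoredBox K₀ → SevenGrowth K₀ →
    ∀ E : WeierstrassCurve (𝓞 K₀), E.Δ ≠ 0 → InResidualRange K₀ E → IsModularEllipticCurve K₀ E

/-! ## §4 Kernel: `[ℚ(j):ℚ] ≤ 2` is never in the residual range; the seven-stable sectors are empty of candidates -/

/-- `[ℚ(j):ℚ] ≤ 2` is NOT in the residual range (`≥ 5`, or `= 4` with `√5 ∈ ℚ(j)`). -/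
theorem not_inResidualRange_of_jDeg_le_two {K₀ : Type} [Field K₀] [NumberField K₀] {E : WeierstrassCurve (𝓞 K₀)}
    (h : jDeg K₀ E ≤ 2) : ¬ InResidualRange K₀ E := by
  rintro (h5 | ⟨h4, -⟩) <;> omega

/-- Stability-or-growth is exhaustive. -/
theorem stable_or_growth (K₀ : Type) [Field K₀] [NumberField K₀] :
    (HeptagonalFree K₀ ∧ SevenStable K₀) ∨ SevenGrowth K₀ := by
  by_cases hg : SevenGrowth K₀
  · exact Or.inr hg
  · refine Or.inl ⟨fun x hx => hg (Or.inl ⟨x, hx⟩), ?_⟩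
    by_contra hst
    exact hg (Or.inr hst)

/-- Growth excludes stability-with-freeness. -/
theorem not_stable_of_growth {K₀ : Type} [Field K₀] [NumberField K₀] (hg : SevenGrowth K₀) :
    ¬ (HeptagonalFree K₀ ∧ SevenStable K₀) := by
  rintro ⟨h7, hst⟩
  rcases hg with ⟨x, hx⟩ | h
  · exact h7 x hx
  · exact h hst

/-- THE DOOR MECHANISM (pointwise): over a totally real seven-stable heptagonal-free `K₀`, a curve that is NOT automorphic of
weight zero has `[ℚ(j):ℚ] ≤ 2` — BOX13 gives the shapes at `3` and `7` (no hypothesis at `5`), SMD the bound. -/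
theorem jDeg_le_two_of_not_automorphic (hB : Box2022_theorem1_3) (hS : SevenModuliDoor) (K₀ : Type) [Field K₀]
    [NumberField K₀] [IsTotallyReal K₀] (h7 : HeptagonalFree K₀) (hst : SevenStable K₀)
    (E : WeierstrassCurve (𝓞 K₀)) (hΔ : E.Δ ≠ 0) (hne : ¬ IsAutomorphicOfWeightZero E) : jDeg K₀ E ≤ 2 := by
  have hshape : BoxShape K₀ E := boxShape_of_box13 hB K₀ E hΔ hne
  exact hS K₀ E hΔ hshape.1 (hshape.2.2 h7) hst

/-- In the residual range over such a field, `E` IS automorphic of weight zero. -/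
theorem automorphic_of_sevenStable (hB : Box2022_theorem1_3) (hS : SevenModuliDoor) (K₀ : Type) [Field K₀]
    [NumberField K₀] [IsTotallyReal K₀] (h7 : HeptagonalFree K₀) (hst : SevenStable K₀)
    (E : WeierstrassCurve (𝓞 K₀)) (hΔ : E.Δ ≠ 0) (hr : InResidualRange K₀ E) : IsAutomorphicOfWeightZero E := by
  by_contra hne
  exact not_inResidualRange_of_jDeg_le_two (jDeg_le_two_of_not_automorphic hB hS K₀ h7 hst E hΔ hne) hr

/-- THE SEVEN-STABLE SECTOR OF LJR IS CLOSED (BOX13 ∧ SMD; no base change, no condition at `5`). -/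
theorem sevenStableSectorLJR_closed (hB : Box2022_theorem1_3) (hS : SevenModuliDoor) : SevenStableSectorLJR := by
  intro K₀ _ _ hb h7 hst E hΔ hr
  haveI : IsTotallyReal K₀ := hb.1
  exact (IsHilbertModular.of_isAutomorphicOfWeightZero hΔ (automorphic_of_sevenStable hB hS K₀ h7 hst E hΔ hr))
    |>.isModularEllipticCurve

/-- … hence the seven-stable sector of RES35 is closed. -/
theorem sevenStableSector35_closed (hB : Box2022_theorem1_3) (hS : SevenModuliDoor) : SevenStableSector35 :=
  fun K₀ _ _ hb _ h7 hst E hΔ hr _ _ _ _ => sevenStableSectorLJR_closed hB hS K₀ hb h7 hst E hΔ hr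

/-- THE SPLIT: RES35 ⟸ BOX13 ∧ SMD ∧ Residual36. -/
theorem residual35_of_pieces (hB : Box2022_theorem1_3) (hS : SevenModuliDoor) (hR : Residual36) : Residual35 := by
  intro K₀ _ _ hb hg E hΔ hr hA hoff h33 hn
  rcases stable_or_growth K₀ with ⟨h7, hst⟩ | hsg
  · exact sevenStableSector35_closed hB hS K₀ hb hg h7 hst E hΔ hr hA hoff h33 hn
  · exact hR K₀ hb hg hsg E hΔ hr hA hoff h33 hn

/-- Junction-free form: RES35 ⟸ SevenStableSector35 ∧ Residual36. -/
theorem residual35_of_sectors (hS : SevenStableSector35) (hR : Residual36) : Residual35 := by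
  intro K₀ _ _ hb hg E hΔ hr hA hoff h33 hn
  rcases stable_or_growth K₀ with ⟨h7, hst⟩ | hsg
  · exact hS K₀ hb hg h7 hst E hΔ hr hA hoff h33 hn
  · exact hR K₀ hb hg hsg E hΔ hr hA hoff h33 hn

/-- NECESSITY: Residual36 is RES35 restricted to a sub-family of fields. -/
theorem residual36_of_residual35 (h : Residual35) : Residual36 :=
  fun K₀ _ _ hb hg _ E hΔ hr hA hoff h33 hn => h K₀ hb hg E hΔ hr hA hoff h33 hn

/-- NECESSITY of the stable sector. -/
theorem sevenStableSector35_of_residual35 (h : Residual35) : SevenStableSector35 :=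
  fun K₀ _ _ hb hg _ _ E hΔ hr hA hoff h33 hn => h K₀ hb hg E hΔ hr hA hoff h33 hn

/-- EXACTNESS (no junction): RES35 ⟺ SevenStableSector35 ∧ Residual36. -/
theorem residual35_iff_sectors : Residual35 ↔ SevenStableSector35 ∧ Residual36 :=
  ⟨fun h => ⟨sevenStableSector35_of_residual35 h, residual36_of_residual35 h⟩, fun h => residual35_of_sectors h.1 h.2⟩

/-- EXACTNESS modulo BOX13 ∧ SMD: RES35 ⟺ Residual36. -/
theorem residual35_iff_residual36 (hB : Box2022_theorem1_3) (hS : SevenModuliDoor) : Residual35 ↔ Residual36 :=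
  ⟨residual36_of_residual35, residual35_of_pieces hB hS⟩

/-- LJR ⟸ BOX13 ∧ SMD ∧ SevenGrowthLJR (the same cut six storeys up). -/
theorem largeJResidual_of_pieces (hB : Box2022_theorem1_3) (hS : SevenModuliDoor) (hG : SevenGrowthLJR) :
    LargeJResidual := by
  intro K₀ _ _ hb E hΔ hr
  rcases stable_or_growth K₀ with ⟨h7, hst⟩ | hsg
  · exact sevenStableSectorLJR_closed hB hS K₀ hb h7 hst E hΔ hr
  · exact hG K₀ hb hsg E hΔ hr

/-- NECESSITY at LJR. -/
theorem sevenGrowthLJR_of_largeJResidual (h : LargeJResidual) : SevenGrowthLJR :=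
  fun K₀ _ _ hb _ E hΔ hr => h K₀ hb E hΔ hr

/-- NECESSITY at LJR (stable sector). -/
theorem sevenStableSectorLJR_of_largeJResidual (h : LargeJResidual) : SevenStableSectorLJR :=
  fun K₀ _ _ hb _ _ E hΔ hr => h K₀ hb E hΔ hr

/-- EXACTNESS at LJR modulo BOX13 ∧ SMD. -/
theorem largeJResidual_iff_sevenGrowthLJR (hB : Box2022_theorem1_3) (hS : SevenModuliDoor) :
    LargeJResidual ↔ SevenGrowthLJR :=
  ⟨sevenGrowthLJR_of_largeJResidual, largeJResidual_of_pieces hB hS⟩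

/-- Residual36 from the LJR-storey residual (restriction). -/
theorem residual36_of_sevenGrowthLJR (h : SevenGrowthLJR) : Residual36 :=
  fun K₀ _ _ hb _ hsg E hΔ hr _ _ _ _ => h K₀ hb hsg E hΔ hr

/-! ## §5 Compositions BY NAME up the lineage (RES34, CORE, REST = stmt-Langlands-26998) -/

/-- RES34 ⟸ BOX13 ∧ FMD ∧ SMD ∧ Residual36 (through g35's `residual34_of_pieces`). -/
theorem residual34_of_pieces36 (hB : Box2022_theorem1_3) (hF : FifteenModuliDoor) (hS : SevenModuliDoor)
    (hR : Residual36) : Residual34 :=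
  residual34_of_pieces hB hF (residual35_of_pieces hB hS hR)

/-- CORE ⟸ the g33/g34 junctions ∧ BOX13 ∧ FMD ∧ SMD ∧ Residual36 (through g35's `core_of_pieces35`). -/
theorem core_of_pieces36 (hNO3 : NearlyOrdinaryDihedralDoorThree) (hNOS : SplitOrdinaryDihedralDoor)
    (hMIX : MixedSignatureDoor) (hNOD : NearlyOrdinaryDistinguishedDoor) (hB : Box2022_theorem1_3)
    (hF : FifteenModuliDoor) (hS : SevenModuliDoor) (hR : Residual36) : CoreResidual :=
  core_of_pieces35 hNO3 hNOS hMIX hNOD hB hF (residual35_of_pieces hB hS hR)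

/-- **REST (stmt-Langlands-26998) BY NAME**: g35's `closes_byName` with `Residual35` replaced by `SMD ∧ Residual36`. -/
theorem closes_byName (hDBC : RatBaseChangeModularity) (hNSBC : SmallFieldBaseChange)
    (hFLS : FLS2015_theorem1) (hDNS : DNS2020_theorem4) (hBox : Box2022_theorem1_1)
    (hADC : AllenDyadicCorollary) (h34 : FLS2015_theorems3_4) (hSW : SkinnerWilesDihedralDoor)
    (hPZ : PanZhangSupersingularDoor) (hNO3 : NearlyOrdinaryDihedralDoorThree) (hNOS : SplitOrdinaryDihedralDoor)
    (hMIX : MixedSignatureDoor) (hNOD : NearlyOrdinaryDistinguishedDoor) (hB : Box2022_theorem1_3)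
    (hF : FifteenModuliDoor) (hS : SevenModuliDoor) (hR : Residual36)
    (hIMT : IntegralModelTransferPointwise)
    (hTr : Summit.Langlands.Langlands.Theses.EllipticDegreeLadder.EllipticTransportAnyBase)
    (hW : Summit.Langlands.Langlands.Theses.EllipticDegreeLadder.SatakeAvatarExistence)
    (h1 : Summit.Langlands.Langlands.Theses.EllipticDegreeLadder.RankOneAutomorphy) :
    Summit.Langlands.Langlands.Theses.TowerDoorSplit.UnanchoredHighDegreeWitnessAutomorphy :=
  Summit.Langlands.Langlands.Theorems.MordellWeilFifteenSplit.closes_byName hDBC hNSBC hFLS hDNS hBox hADC h34 hSW hPZ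
    hNO3 hNOS hMIX hNOD hB hF (residual35_of_pieces hB hS hR) hIMT hTr hW h1

/-! ### Necessity from the lineage targets (the trivial direction) -/

/-- CORE ⟹ Residual36. -/
theorem residual36_of_core (h : CoreResidual) : Residual36 :=
  residual36_of_residual35 (residual35_of_core h)

/-- REST_E ⟹ Residual36. -/
theorem residual36_of_restE (h : UnanchoredHighDegreeModularE) : Residual36 :=
  residual36_of_residual35 (residual35_of_restE h)

/-- LJR storey: REST_E ⟹ SevenGrowthLJR. -/
theorem sevenGrowthLJR_of_restE (h : UnanchoredHighDegreeModularE) : SevenGrowthLJR :=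
  sevenGrowthLJR_of_largeJResidual (largeJResidual_of_restE h)

/-- EXACTNESS at CORE modulo the junctions: CORE ⟺ Residual36. -/
theorem core_iff_residual36 (hNO3 : NearlyOrdinaryDihedralDoorThree) (hNOS : SplitOrdinaryDihedralDoor)
    (hMIX : MixedSignatureDoor) (hNOD : NearlyOrdinaryDistinguishedDoor) (hB : Box2022_theorem1_3)
    (hF : FifteenModuliDoor) (hS : SevenModuliDoor) : CoreResidual ↔ Residual36 :=
  ⟨residual36_of_core, core_of_pieces36 hNO3 hNOS hMIX hNOD hB hF hS⟩

/-! ## §6 One storey above the residual range: the ABSOLUTE CRITERIA (every totally real field) -/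

/-- On a field with NO QUADRATIC SUBFIELD, `[ℚ(j):ℚ] ≤ 2` forces `[ℚ(j):ℚ] ≤ 1`. -/
theorem jDeg_le_one_of_noQuadraticSubfield {K₀ : Type} [Field K₀] [NumberField K₀] (hK : NoQuadraticSubfield K₀)
    {E : WeierstrassCurve (𝓞 K₀)} (h : jDeg K₀ E ≤ 2) : jDeg K₀ E ≤ 1 := by
  have h2 : Module.finrank ℚ ℚ⟮jInv K₀ E⟯ ≠ 2 := hK ℚ⟮jInv K₀ E⟯
  change Module.finrank ℚ ℚ⟮jInv K₀ E⟯ ≤ 2 at h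
  change Module.finrank ℚ ℚ⟮jInv K₀ E⟯ ≤ 1
  omega

/-- `ℚ(ζ₇)⁺ ⊄ K` whenever `3 ∤ [K:ℚ]` (tree `Box2022.cubic7_ne_zero`, by name). -/
theorem heptagonalFree_of_not_three_dvd {K : Type} [Field K] [NumberField K] (h3 : ¬ 3 ∣ Module.finrank ℚ K) :
    HeptagonalFree K :=
  fun x => Box2022.cubic7_ne_zero h3 x

/-- **ABSOLUTE CRITERION, no-quadratic-subfield form** (CLOSED from BOX13 ∧ SMD ∧ DBC): over ANY totally real `K` with no
quadratic subfield, `ℚ(ζ₇)⁺ ⊄ K`, `21A1(K) = 21A1(ℚ)` and `49A4(K) = 49A4(ℚ)`, every integral `E` is modular — a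
non-automorphic `E` has `[ℚ(j):ℚ] ≤ 2`, hence `j ∈ ℚ`, and DBC applies.  No hypothesis at `5`; `7` may ramify. -/
theorem modular_of_sevenStable_noQuadratic (hB : Box2022_theorem1_3) (hS : SevenModuliDoor)
    (hDBC : RatBaseChangeModularity) (K : Type) [Field K] [NumberField K] [IsTotallyReal K]
    (hK : NoQuadraticSubfield K) (h7 : HeptagonalFree K) (hst : SevenStable K)
    (E : WeierstrassCurve (𝓞 K)) (hΔ : E.Δ ≠ 0) : IsModularEllipticCurve K E := by
  by_cases hmod : IsAutomorphicOfWeightZero E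
  · exact (IsHilbertModular.of_isAutomorphicOfWeightZero hΔ hmod).isModularEllipticCurve
  · have h1 : jDeg K E ≤ 1 :=
      jDeg_le_one_of_noQuadraticSubfield hK (jDeg_le_two_of_not_automorphic hB hS K h7 hst E hΔ hmod)
    obtain ⟨q, hq⟩ := exists_ratCast_eq_of_jDeg_le_one K E h1
    exact isModularEllipticCurve_of_jInv_eq_ratCast hDBC K E hΔ q hq.symm

/-- **ABSOLUTE CRITERION, degree prime to `6`** (CLOSED from BOX13 ∧ SMD ∧ DBC): over ANY totally real `K` with `2 ∤ [K:ℚ]`,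
`3 ∤ [K:ℚ]`, `21A1(K) = 21A1(ℚ)` and `49A4(K) = 49A4(ℚ)`, every integral `E` is modular.  Compare TowerDoorSplit B7 (anchor
`F` of degree `≤ 5`, `K₀/F` Galois solvable odd, `7 ∤ disc K₀`) and [Yoshikawa2022, Cor. 3.6 (2)] (`K ⊂ F_∞`, `7` unramified). -/
theorem modular_of_sevenStable_coprime6 (hB : Box2022_theorem1_3) (hS : SevenModuliDoor)
    (hDBC : RatBaseChangeModularity) (K : Type) [Field K] [NumberField K] [IsTotallyReal K]
    (h2 : ¬ 2 ∣ Module.finrank ℚ K) (h3 : ¬ 3 ∣ Module.finrank ℚ K) (hst : SevenStable K)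
    (E : WeierstrassCurve (𝓞 K)) (hΔ : E.Δ ≠ 0) : IsModularEllipticCurve K E :=
  modular_of_sevenStable_noQuadratic hB hS hDBC K (noQuadraticSubfield_of_not_two_dvd h2)
    (heptagonalFree_of_not_three_dvd h3) hst E hΔ

/-- The CELL of REST_E this closes (box form): unanchored `K₀` with no quadratic subfield, heptagonal-free and seven-stable. -/
theorem restE_cell_sevenStable (hB : Box2022_theorem1_3) (hS : SevenModuliDoor) (hDBC : RatBaseChangeModularity)
    (K₀ : Type) [Field K₀] [NumberField K₀] (hb : UnanchoredBox K₀) (hK : NoQuadraticSubfield K₀)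
    (h7 : HeptagonalFree K₀) (hst : SevenStable K₀) (E : WeierstrassCurve (𝓞 K₀)) (hΔ : E.Δ ≠ 0) :
    IsModularEllipticCurve K₀ E := by
  haveI : IsTotallyReal K₀ := hb.1
  exact modular_of_sevenStable_noQuadratic hB hS hDBC K₀ hK h7 hst E hΔ

/-! ## §7 Sanity: the models and their rational points (the stability predicates are about THESE curves) -/

/-- The affine equation of `21A1` over any field of characteristic `0`. -/
theorem E21_equation_iff {K : Type} [Field K] [CharZero K] (x y : K) :
    (E21.baseChange K).toAffine.Equation x y ↔ y ^ 2 + x * y = x ^ 3 - 4 * x - 1 := by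
  rw [WeierstrassCurve.Affine.equation_iff]
  simp only [E21, WeierstrassCurve.baseChange, WeierstrassCurve.map, WeierstrassCurve.toAffine, map_one, map_zero,
    map_neg, map_ofNat]
  constructor <;> intro h <;> linear_combination h

/-- The affine equation of `49A4` over any field of characteristic `0`. -/
theorem E49_equation_iff {K : Type} [Field K] [CharZero K] (x y : K) :
    (E49.baseChange K).toAffine.Equation x y ↔ y ^ 2 + x * y = x ^ 3 - x ^ 2 - 1822 * x + 30393 := by
  rw [WeierstrassCurve.Affine.equation_iff]
  simp only [E49, WeierstrassCurve.baseChange, WeierstrassCurve.map, WeierstrassCurve.toAffine, map_one, map_zero,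
    map_neg, map_ofNat]
  constructor <;> intro h <;> linear_combination h

/-- The seven affine rational points of `21A1` (`ℤ/2 ⊕ ℤ/4` minus `O`): the three `2`-torsion points `(2,−1)`, `(−2,1)`,
`(−1/4, 1/8)` and `(−1, 2)`, `(−1, −1)`, `(5, 8)`, `(5, −13)`. -/
theorem E21_listed_points :
    (E21.baseChange ℚ).toAffine.Equation 2 (-1) ∧ (E21.baseChange ℚ).toAffine.Equation (-2) 1 ∧
    (E21.baseChange ℚ).toAffine.Equation (-1/4) (1/8) ∧ (E21.baseChange ℚ).toAffine.Equation (-1) 2 ∧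
    (E21.baseChange ℚ).toAffine.Equation (-1) (-1) ∧ (E21.baseChange ℚ).toAffine.Equation 5 8 ∧
    (E21.baseChange ℚ).toAffine.Equation 5 (-13) := by
  refine ⟨?_, ?_, ?_, ?_, ?_, ?_, ?_⟩ <;> exact (E21_equation_iff _ _).mpr (by norm_num)

/-- The affine rational point of `49A4` (`ℤ/2` minus `O`): the `2`-torsion point `(99/4, −99/8)`. -/
theorem E49_listed_point : (E49.baseChange ℚ).toAffine.Equation (99/4 : ℚ) (-99/8) :=
  (E49_equation_iff _ _).mpr (by norm_num)

/-- `c₄(21A1) = 193` (as in TowerDoorSplit B7's `X₀(21)`). -/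
theorem E21_c₄ : E21.c₄ = 193 := by
  simp only [E21, WeierstrassCurve.c₄, WeierstrassCurve.b₂, WeierstrassCurve.b₄]; norm_num

/-- `Δ(21A1) = 3⁴ · 7²` (conductor `21`, as in TowerDoorSplit B7's `X₀(21)`). -/
theorem E21_Δ : E21.Δ = 3 ^ 4 * 7 ^ 2 := by
  simp only [E21, WeierstrassCurve.Δ, WeierstrassCurve.b₂, WeierstrassCurve.b₄, WeierstrassCurve.b₆,
    WeierstrassCurve.b₈]; norm_num

/-- `Δ(49A4) = 7⁹` (conductor `49`; `j(49A4) = 255³`, CM by `ℤ[√−7]`). -/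
theorem E49_Δ : E49.Δ = 7 ^ 9 := by
  simp only [E49, WeierstrassCurve.Δ, WeierstrassCurve.b₂, WeierstrassCurve.b₄, WeierstrassCurve.b₆,
    WeierstrassCurve.b₈]; norm_num

end Summit.Langlands.Langlands.Theorems.MordellWeilSevenSplit
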